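import Mathlib.Algebra.Field.Subfield.Basic
import Mathlib.Algebra.MvPolynomial.CommRing
import Mathlib.RingTheory.Ideal.Maps
import Mathlib.Data.PNat.Basic
import Mathlib.Algebra.BigOperators.Fin
import HarnessLib

/-!
# Kummer genericity: division sequences are finitely determined (Bays–Kirby 2018, Prop. 3.22/3.24)

The arithmetic heart of the theory of Zilber's pseudo-exponential fields is the following
consequence of Kummer theory for the torus `𝔾ₘⁿ` over finitely generated extensions of
`ℚ(μ_∞)` ("the Thumbtack Lemma", Zilber 2006; Bays–Zilber 2011, Thm 2.3; Kirby 2013, *Finitely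
presented exponential fields*, Facts 2.15, 2.16, 3.7; Bays–Kirby 2018, Prop. 3.22 with Prop. 3.24).
In the language of Bays–Kirby 2018 (case (EXP), `G = 𝔾ₐ × 𝔾ₘ`, `𝒪 = ℤ`, base field `ℚ`), for a
finitely generated Γ-field `A` and a finitely generated kernel-preserving extension `B` with basis
`b ∈ Γ(B)ⁿ`:

> **Prop. 3.22.** There is `m ∈ ℕ⁺` such that any `m`-th division point of `b` in `Γ(B)` is a
> good basis. (Proof, Case (EXP): by Prop. 3.24 the Kummer map `ξ_{b₂}` of the multiplicative
> part has open image in the Tate module; "Hence, if `b'` is an `m`-th division point of `b` we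
> have `ξ_{b'₂}(Gal(A(b')^{alg}/A(b'))) = T(𝔾ₘⁿ)`. So all division sequences of `b'` have the
> same ACF-type over `A(b')`.")

Here `A = ℚ(Γ(A)) = ℚ(μ_∞, a₁, a₂, √a₂)` is generated by the roots of unity, the additive
coordinates `a₁`, and *all* roots `√a₂` of the multiplicative coordinates `a₂` of a basis of
`Γ(A)` over the torsion; `A(b') = A(b'₁, b'₂)`; and the standing hypothesis "same kernels" says
exactly that `(a₂, b₂)` is multiplicatively independent modulo roots of unity (proof of
Prop. 3.22: "`(a₂, b₂)` is `k_𝒪`-linearly independent over `D₂ = Tor₂`, and so is free in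
`G₂^{n+k}` over `D₂`", the hypothesis of Prop. 3.24 with `H = 𝔾ₘ^{n+k}`, `D = Tor(H)`).

This file vendors that statement, about fields only (no exponential map), as the named fact
`Literature.FieldTheory.Kummer.BaysKirby2018_divisionSequences_determined`, in the following form. Inside a field `Ω` of
characteristic zero let `S ⊆ Ω` be finite, `b : Fin r → Ωˣ`, `c : Fin n → Ωˣ` with `(b, c)`
multiplicatively independent modulo roots of unity, and let
`L = ℚ(μ_∞ ∪ S ∪ √b₁ ∪ … ∪ √b_r)` (`Literature.FieldTheory.Kummer.baseField`). Then there is `m ≥ 1` such that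
for every tuple `c'` of `m`-th roots of `c`, any two *division systems* below `c'` — one in `Ω`,
one in an arbitrary field extension `Ω₂` of `L(c')` — have the same field type over `L(c')`:
the ideals of polynomial relations over `L(c')` of the two families `(c'^{1/k})_{k ≥ 1}` coincide
(`Literature.FieldTheory.Kummer.IsDivisionSystem`; Bays–Zilber 2011, Def. 2.2: "division systems below `c` are
finitely determined over `K`"). Equality of these ideals is the same as an isomorphism
`L(c')(ρ) ≅ L(c')(σ)` over `L(c')` matching the two systems, i.e. Kirby's "exactly one
isomorphism type over `F` of an `n`-tuple of coherent systems of roots" (Fact 3.7) and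
Bays–Kirby's "same ACF-type over `A(b')`".

The fact is deep (Kummer theory over `ℚ(μ_∞)`-extensions of finite type: Bays–Zilber 2011,
Prop. 2.5; Bays–Hart–Pillay, Bays–Gavrilovich–Hils for Prop. 3.24) and is recorded as a named
fact (D-0014). It is the remaining input, beyond the axioms, of the `ℵ₀`-saturation of Zilber
fields for exponentially-algebraic extensions (Bays–Kirby 2018, Lemma 8.3;
`Literature.NumberTheory.Transcendental.BaysKirby2018_saturation_of_isStronglyExpAlgClosed` in `ZilberFieldHomogeneity.lean`).

## Contents

* `Literature.Kummer.allRoots y` — the set `√y` of all `k`-th roots of `y`, `k ≥ 1` (so `allRoots 1` is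
  the set `μ_∞` of roots of unity);
* `Literature.Kummer.baseField S b` — the subfield `ℚ(μ_∞ ∪ S ∪ ⋃ᵢ √bᵢ)`;
* `Literature.Kummer.IsDivisionSystem c ρ` — `ρ : ℕ⁺ → (ι → Ω)` is a division system below `c`:
  `ρ 1 = c` and `(ρ (m k))ᵏ = ρ m`;
* `Literature.Kummer.MulIndepModTorsion v` — no non-trivial monomial in `v` is a root of unity;
* `Literature.FieldTheory.Kummer.BaysKirby2018_divisionSequences_determined` — the named fact.

## References

* M. Bays, J. Kirby, *Pseudo-exponential maps, variants, and quasiminimality*, Algebra & Number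
  Theory 12 (2018) 493–549: Def. 3.19, Prop. 3.22 (and its proof, Case (EXP)), Prop. 3.24.
* J. Kirby, *Finitely presented exponential fields*, Algebra & Number Theory 7 (2013) 943–980:
  Def. 2.5 (coherent system of roots), Fact 2.15, Fact 2.16, Fact 3.7 (Thumbtack Lemma).
* M. Bays, B. Zilber, *Covers of multiplicative groups of algebraically closed fields of arbitrary
  characteristic*, Bull. LMS 43 (2011) 689–702: Def. 2.2, Thm 2.3, Prop. 2.5.
-/

noncomputable section

open Set

universe u

namespace Literature.FieldTheory.Kummer

section Kummer

variable {Ω : Type*} [Field Ω]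

/-- The set `√y` of **all roots** of `y`: elements `x` with `xᵏ = y` for some `k ≥ 1`
(Kirby 2013, before Fact 2.15: "we write `√b` for the set of all the `m`-th roots of `b` for all
`m ∈ ℕ`"). `allRoots 1` is the set of roots of unity. [cite: Kirby2013FPEF, §2 (before Fact 2.15)] -/
def allRoots (y : Ω) : Set Ω :=
  {x | ∃ k : ℕ, 0 < k ∧ x ^ k = y}

/-- Membership in `allRoots`. [folklore] -/
theorem mem_allRoots_iff {y x : Ω} : x ∈ allRoots y ↔ ∃ k : ℕ, 0 < k ∧ x ^ k = y :=
  Iff.rfl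

/-- `y` is a (first) root of itself. [folklore] -/
theorem self_mem_allRoots (y : Ω) : y ∈ allRoots y :=
  ⟨1, one_pos, pow_one y⟩

/-- `1` is a root of unity. [folklore] -/
theorem one_mem_allRoots_one : (1 : Ω) ∈ allRoots (1 : Ω) :=
  self_mem_allRoots 1

/-- The **base field** `ℚ(μ_∞ ∪ S ∪ ⋃ᵢ √bᵢ)` generated by all roots of unity, a set `S`, and all
roots of the `bᵢ` (Kirby 2013, Fact 2.15: `F = ℚ^{ab}(a₁,…,a_r, √b₁,…,√b_r)`; Bays–Kirby 2018,
proof of Prop. 3.22: the finitely generated Γ-field `A = ℚ(μ_∞, a₁, a₂, √a₂)`).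
[cite: Kirby2013FPEF, Fact 2.15] -/
def baseField (S : Set Ω) {r : ℕ} (b : Fin r → Ω) : Subfield Ω :=
  Subfield.closure (allRoots (1 : Ω) ∪ S ∪ ⋃ i, allRoots (b i))

/-- Elements of `S` lie in the base field. [folklore] -/
theorem mem_baseField_of_mem {S : Set Ω} {r : ℕ} (b : Fin r → Ω) {x : Ω} (hx : x ∈ S) :
    x ∈ baseField S b :=
  Subfield.subset_closure (Or.inl (Or.inr hx))

/-- Roots of unity lie in the base field. [folklore] -/
theorem mem_baseField_of_mem_allRoots_one {S : Set Ω} {r : ℕ} (b : Fin r → Ω) {x : Ω}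
    (hx : x ∈ allRoots (1 : Ω)) : x ∈ baseField S b :=
  Subfield.subset_closure (Or.inl (Or.inl hx))

/-- All roots of the `bᵢ` lie in the base field. [folklore] -/
theorem mem_baseField_of_mem_allRoots {S : Set Ω} {r : ℕ} (b : Fin r → Ω) (i : Fin r) {x : Ω}
    (hx : x ∈ allRoots (b i)) : x ∈ baseField S b :=
  Subfield.subset_closure (Or.inr (mem_iUnion.2 ⟨i, hx⟩))

/-- A **division system below `c`** (Bays–Zilber 2011, Def. 2.2; Kirby 2013, Def. 2.5 "coherent
system of roots"): a family `ρ m` (`m ≥ 1`) of tuples with `ρ 1 = c` and `(ρ (m k))ᵏ = ρ m`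
coordinatewise — so `ρ m` is a tuple of `m`-th roots of `c`, chosen coherently.
[cite: BaysZilber2011Covers, Def. 2.2] -/
def IsDivisionSystem {ι : Type*} (c : ι → Ω) (ρ : ℕ+ → ι → Ω) : Prop :=
  ρ 1 = c ∧ ∀ (m k : ℕ+) (i : ι), ρ (m * k) i ^ (k : ℕ) = ρ m i

/-- In a division system, `(ρ k)ᵏ = c`. [folklore] -/
theorem IsDivisionSystem.pow_eq {ι : Type*} {c : ι → Ω} {ρ : ℕ+ → ι → Ω}
    (h : IsDivisionSystem c ρ) (k : ℕ+) (i : ι) : ρ k i ^ (k : ℕ) = c i := by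
  have := h.2 1 k i
  rwa [one_mul, h.1] at this

/-- **Multiplicative independence modulo roots of unity**: no non-trivial Laurent monomial
`∏ vᵢ ^ uᵢ` (`u ∈ ℤ^ι ∖ {0}`) is a root of unity (Bays–Kirby 2018, proof of Prop. 3.22: "free in
`𝔾ₘ^{n+k}` over `Tor`"; Kirby 2013, Fact 2.15: "multiplicatively independent").
[cite: BaysKirby2018ANT, Prop. 3.24 (freeness over `D = Tor(H)`)] -/
def MulIndepModTorsion {ι : Type*} [Fintype ι] (v : ι → Ω) : Prop :=
  ∀ u : ι → ℤ, (∏ i, v i ^ u i) ∈ allRoots (1 : Ω) → u = 0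

/-- The trivial monomial is a root of unity, so `MulIndepModTorsion` only constrains `u ≠ 0`.
[folklore] -/
theorem prod_zpow_zero_mem_allRoots {ι : Type*} [Fintype ι] (v : ι → Ω) :
    (∏ i, v i ^ (0 : ι → ℤ) i) ∈ allRoots (1 : Ω) := by
  simp [one_mem_allRoots_one]

/-- The tuple `c'`, regarded as a tuple of elements of the base field `L = ℚ(μ_∞ ∪ S ∪ c' ∪ √b)`
over which division systems below `c'` are compared. [folklore] -/
def baseTuple (S : Set Ω) {r n : ℕ} (b : Fin r → Ω) (c' : Fin n → Ω) (j : Fin n) :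
    baseField (S ∪ range c') b :=
  ⟨c' j, mem_baseField_of_mem b (Or.inr (mem_range_self j))⟩

/-- `baseTuple` is `c'`. [folklore] -/
@[simp] theorem coe_baseTuple (S : Set Ω) {r n : ℕ} (b : Fin r → Ω) (c' : Fin n → Ω) (j : Fin n) :
    (baseTuple S b c' j : Ω) = c' j := rfl

end Kummer

/-- NAMED FACT — **division sequences below a good division point are determined**
(Bays–Kirby 2018, Prop. 3.22 "existence of good bases", Case (EXP) with `A` finitely generated,
together with its proof and Prop. 3.24 (Kummer theory, `H = 𝔾ₘⁿ`, `D = Tor(H)`); equivalently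
Kirby 2013 (*Finitely presented exponential fields*) Facts 2.15 and 3.7, the Thumbtack Lemma of
Zilber 2006 / Bays–Zilber 2011 Thm 2.3 over `ℚ(μ_∞)`-based fields).
Let `Ω` be a field of characteristic zero, `S ⊆ Ω` finite, `b ∈ (Ωˣ)ʳ`, `c ∈ (Ωˣ)ⁿ` with
`(b, c)` multiplicatively independent modulo roots of unity. Then there is `m ≥ 1` such that for
every tuple `c'` of `m`-th roots of `c` ("any `m`-th division point"), writing
`L = ℚ(μ_∞ ∪ S ∪ c' ∪ √b₁ ∪ … ∪ √b_r)` (`= A(b')` in Bays–Kirby's proof): for every division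
system `ρ` below `c'` in `Ω` and every division system `σ` below `c'` in any field extension
`Ω₂` of `L`, the families `(ρ_k)_{k ≥ 1}` and `(σ_k)_{k ≥ 1}` satisfy the same polynomial
relations over `L` — "all division sequences of `b'` have the same ACF-type over `A(b')`".
(Equivalently: `L(ρ) ≅ L(σ)` over `L` with `ρ_k ↦ σ_k`, Kirby's "exactly one isomorphism type
over `F` of an `n`-tuple of coherent systems of roots of the `c'ᵢ`".) Deep; named fact (D-0014).
[cite: BaysKirby2018ANT, Prop. 3.22 (with its proof, Case (EXP)) and Prop. 3.24]
[cite: Kirby2013FPEF, Fact 2.15, Fact 3.7] [cite: BaysZilber2011Covers, Thm 2.3] -/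
def BaysKirby2018_divisionSequences_determined : Prop :=
  ∀ {Ω : Type u} [Field Ω] [CharZero Ω] (S : Set Ω), S.Finite →
    ∀ {r n : ℕ} (b : Fin r → Ω) (c : Fin n → Ω), (∀ i, b i ≠ 0) → (∀ j, c j ≠ 0) →
      MulIndepModTorsion (Fin.append b c) →
      ∃ m : ℕ, 0 < m ∧ ∀ c' : Fin n → Ω, (∀ j, c' j ^ m = c j) →
        ∀ ρ : ℕ+ → Fin n → Ω, IsDivisionSystem c' ρ →
          ∀ (Ω₂ : Type u) [Field Ω₂] [Algebra (baseField (S ∪ range c') b) Ω₂]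
            (σ : ℕ+ → Fin n → Ω₂),
            IsDivisionSystem (fun j => algebraMap (baseField (S ∪ range c') b) Ω₂
              (baseTuple S b c' j)) σ →
            RingHom.ker (MvPolynomial.aeval (fun p : ℕ+ × Fin n => ρ p.1 p.2) :
                MvPolynomial (ℕ+ × Fin n) (baseField (S ∪ range c') b) →ₐ[baseField (S ∪ range c') b] Ω) =
              RingHom.ker (MvPolynomial.aeval (fun p : ℕ+ × Fin n => σ p.1 p.2) :
                MvPolynomial (ℕ+ × Fin n) (baseField (S ∪ range c') b) →ₐ[baseField (S ∪ range c') b] Ω₂)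

end Literature.FieldTheory.Kummer
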